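import Summits.QuantumFields.BalabanUV.Beta.KernelWardMixedLaw

/-!
# `BalabanUV.Beta.KernelWardResponse` — binder row D1, W-side socket (L4) of the Ward binder hW: THE RESPONSE PIECE OF THE
# SECOND-ORDER WARD DIVERGENCE READS THE PURE-GAUGE MODE (kernel algebra of the fourth summand `dM (K2OfK …) N S M μ y` of `W2OfK`)
# (β sub-cell, lineage an1 = «direct one-loop in Bałaban's gauge», gen 27; sequel of `KernelWardMColumn`, `KernelWardCoarseExchange`,
# `KernelWardMixedLaw`)

NOT IN PRINT; OUR BOOKKEEPING.  HONEST FRAMING (cell contract, verbatim): «discharging `BetaPertH` makes Bałaban's UV stability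
UNCONDITIONAL — a real constructive-QFT result; it is NOT the continuum limit and NOT the Clay problem.»  HONEST DEPENDENCY (verbatim):
«continuum YM on T⁴ ⇐ BetaPertH ∧ nine spine estimates (0/9 proved); BetaPertH ⇐ (D1) ∧ (D4) ∧ CAP+tail; G-an2-4 gates asym, D1 and
NE2/3/4.»  This module is [folklore] linear algebra over tree objects BY NAME; it types no statement of Bałaban's papers, carries no
`[cite:]` tag and no `Prop` fact, instantiates NO binder of the β-function wall, and is NOT D1, NOT `BetaPertH`, NOT continuum, NOT Clay.

## What is proved, and where it sits

The W-side socket (L4) of hW asks for the coarse divergence, in the first bond `(μ, y)`, of an2's second-order carrier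
`SecondOrderResponse.W2OfK K N S M S₂ M₂` over the wall's step propagators `G_j := coDressKBmAt ρ_c Lc (KInvStep Lc j)`
(`WardLocusRecursiveEnd.wardTransversal_flipK_TbalOf_JsRecBmAtOf`, hypothesis `hWd`).  `KernelWardMixedLaw.divW_W2OfK_of_tableLaws` reduced
it, under the bare table laws, to
`conjV (dM …) (X y) + dM K N (R y) (R^M y) ν y′ + divW (fun μ y ν y′ ↦ dM (K2OfK K N S M ν y′) N S M μ y) y ν y′`,
leaving the last summand — the RESPONSE PIECE, built on the differentiated propagator `K2OfK K N S M ν y′ = −K ∘ dM … ∘ K` —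
symbolic.  THIS FILE computes it.  No table law is used: only the column Ward laws of `K` itself.

* §1 `decays_of_biLoc`: a bi-localised kernel decays (bookkeeping).
* §2 ROW LAW OF A RIGHT SANDWICH (`row_comp_ward`): for a decaying `A` and a bounded `K` whose field columns obey the ℋ-column Ward law
  (hH) `Σ_μ (colH K N μ (y − e_μ) κ u − colH K N μ y κ u) = c_H · gaugeWt N y κ u` (leaf-07 / an1, `KernelWardHColumnWall`) and whose
  multiplier rows obey the FULL homogeneous law (hM♯) `Σ_μ (K x₂ (N•(y − e_μ)) (inr ρ) (inr μ) − K x₂ (N•y) (inr ρ) (inr μ)) = 0` at EVERY fine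
  `x₂` (= `KernelWardMColumn.colM_…_ward` on the coarse lattice, `KInvStep_inr_off` off it: `rowM_ward_of_packed`), the multiplier columns of
  `A ∘ K` satisfy
  `Σ_μ (comp A K x (N•(y − e_μ)) a (inr μ) − comp A K x (N•y) a (inr μ)) = c_H · Σ′_{x₂} Σ_{κ₂} A x x₂ a (inl κ₂) · gaugeWt N y κ₂ x₂`:
  the sandwich READS THE PURE-GAUGE MODE `ĝ_y := gaugeWt N y` (supported on the bonds crossing `∂B(y)`, `KernelWardRelative.gaugeWt`)
  THROUGH `A` (its `colH` / `colM` instances are the rows `(u, inl κ)` / `(N•w, inr ρ)`, by `rfl`).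
* §3 `K2OfK_eq_comp_neg`: `K2OfK K N S M ν y′ = comp (−(K ∘ dM K N S M ν y′)) K` (the differentiated propagator is a right sandwich).
* §4 `divV_dM_comp`: `divV (dM (comp A K) N S M) y = c_H • (Σ_κ wsum (u ↦ (Aĝ_y)(u, inl κ)) (S κ) + Σ_ρ cwsum N (w ↦ (Aĝ_y)(N•w, inr ρ)) (M ρ))`
  (block bookkeeping of both halves BY NAME: an1's `KernelWardRelative.divV_vertexOfK`, leaf-10's `WardLocusSecondOrder.divV_vertexOfM_of_bdd`;
  then §2 inside the weights).
* §5 THE RESPONSE PIECE (`divW_response`): with `A := −(K ∘ dM K N S M ν y′)` (`K2OfK = comp A K`, `K2OfK_eq_comp_neg`),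
  `divW (fun μ y ν y′ ↦ dM (K2OfK K N S M ν y′) N S M μ y) y ν y′ = −(c_H • 𝒟_{S,M}[(K ∘ dM K N S M ν y′) ĝ_y])`, spelled out; and its
  instance over the wall propagator `G_j` at every level `j` and every in-block root, with `c_H = (stepScale d Lc j · Lc^{d+1})⁻¹`
  (`divW_response_coDressKBmAt_KInvStep`; (hH) := `KernelWardHColumnWall.colH_ward_KInvStep_all`, (hM♯) := `rowM_ward_coDressKBmAt_KInvStep`).
* §7 THE COMPLETE FIRST-SLOT DIVERGENCE OF THE CARRIER MODULO TABLE LAWS (`divW_W2OfK_of_tableLaws_response`): an1's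
  `KernelWardMixedLaw.divW_W2OfK_of_tableLaws` with its symbolic response summand evaluated by §5 —
  `divW (W2OfK K N S M S₂ M₂) y ν y′ = conjV (dM K N S M ν y′) (X y) + dM K N (R y) (R^M y) ν y′ − c_H • 𝒟_{S,M}[(K ∘ dM K N S M ν y′) ĝ_y]`
  — and its wall instance over `G_j` (`divW_W2OfK_coDressKBmAt_KInvStep_of_tableLaws_response`).  Nothing symbolic remains on the
  propagator side; every remaining hypothesis is a law of the TABLES.

What this file does NOT do: the TABLE-LEVEL half of the response identity — the kernel-slot law for `dM K N S M ν y′` applied to the gauge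
mode `ĝ_y`, the relative-inverse identity `K𝕄 = 1 − Π_ax`, and the first-slot law of `𝒟_{S,M}` against the rotated mode, which together should
turn the right-hand side of §5 plus `dM K N (R y) (R^M y) ν y′` into `conjV 𝕄_j (X₂ j y ν y′) + N^r` with `N^r` local and tadpole-null (the
remaining content of `hWd`; statement level, toy first — an1's `SKELETON-D1-L4-HW`).
-/

noncomputable section

open Finset
open scoped BigOperators
open Literature.Probability.LatticeModels (Torus.proj)
open Literature.MathematicalPhysics.QuantumFieldTheory
open Literature.MathematicalPhysics.QuantumFieldTheory.Balaban1983to89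
open Literature.MathematicalPhysics.QuantumFieldTheory.Balaban1983to89.Beta
open B12Sec2to5 (l1 l1_nonneg)
open B6BondElimination (unitVec)
open ExpKernelCalculus (MKer Decays BiLoc VertexFamily comp Zl summable_exp_shift l1_sub_triangle l1_sub_symm biLoc_comp_decays)
open KernelWard (divV divW bdd_of_decays bdd_of_biLoc)
open AffineAveraging (Site box toSite)
open OneStepResolventKernel (Fib wsum LocStencil biLoc_mono decays_mono eq_zsmul_quo_of_proj)
open OneStepKernelFamily (KInvStep colH vertexOfK KInvStep_inr_off)
open InterLevelTransport (cwsum cwsum_apply)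
open SecondOrderResponse (colM vertexOfM dM K2OfK W2OfK vertexFamily_dM biLoc_neg)
open BalabanStepJetsSucc (decays_comp)
open Summit.QuantumFields.BalabanUV.Beta.TameKernelCalculus
open Summit.QuantumFields.BalabanUV.Beta.ChartConjugationReflection (summable_abs_colH abs_le_of_locStencil)
open Summit.QuantumFields.BalabanUV.Beta.BorderedHessian (stepScale)
open Summit.QuantumFields.BalabanUV.Beta.AxialDressingRooted (coDressKBmAt coDressKBmAt_inr_inr decays_coDressKBmAt_KInvStep)
open Summit.QuantumFields.BalabanUV.Beta.KernelWardRelative (gaugeWt divV_vertexOfK)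
open Summit.QuantumFields.BalabanUV.Beta.KernelWardHColumnWall (colH_ward_KInvStep_all)
open Summit.QuantumFields.BalabanUV.Beta.ChartConjugation (conjV)
open Summit.QuantumFields.BalabanUV.Beta.KernelWardMColumn (divV_add colM_coDressKBmAt_KInvStep_ward)
open Summit.QuantumFields.BalabanUV.Beta.WardLocusSecondOrder (divV_vertexOfM_of_bdd)
open Summit.QuantumFields.BalabanUV.Beta.KernelWardMixedLaw (divW_W2OfK_of_tableLaws)

namespace Summit.QuantumFields.BalabanUV.Beta.KernelWardResponse

variable {d : ℕ}

/-! ## §1 Bookkeeping: a bi-localised kernel decays -/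

/-- [folklore] A kernel bi-localised at `(p, q)` at rate `δ ≥ 0` decays off the diagonal at the same rate, constant `C·e^{δ|p−q|₁}`
(triangle inequality `|x−y|₁ ≤ |x−p|₁ + |p−q|₁ + |q−y|₁`). -/
theorem decays_of_biLoc {D : ℕ} {F : Type*} {K : MKer D F} {p q : Site D} {C δ : ℝ} (h : BiLoc K p q C δ) (hδ : 0 ≤ δ) :
    Decays K (C * Real.exp (δ * l1 (p - q))) δ := by
  intro x y a b
  refine (h x y a b).trans ?_
  rw [mul_assoc, ← Real.exp_add]
  refine mul_le_mul_of_nonneg_left (Real.exp_le_exp.2 ?_) (h.nonneg a)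
  have h1 := l1_sub_triangle x p y
  have h2 := l1_sub_triangle p q y
  rw [l1_sub_symm q y] at h2
  have h3 : l1 (x - y) ≤ l1 (x - p) + (l1 (p - q) + l1 (y - q)) := h1.trans (by linarith)
  nlinarith [mul_le_mul_of_nonneg_left h3 hδ, l1_nonneg (x - p), l1_nonneg (y - q)]

/-! ## §2 The multiplier columns of a right sandwich `A ∘ K` read the pure-gauge mode through `A` -/

section Row

variable {N : ℕ}

/-- [folklore] **ROW LAW OF A RIGHT SANDWICH.**  Let `A` decay and `K` be bounded, with (hH) the ℋ-column Ward law of `K` with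
contact `c_H` and (hM♯) the full homogeneous multiplier-row law of `K` (every fine row index `x₂`).  Then for every row `(x, a)` the
multiplier columns of `A ∘ K` have coarse divergence
`Σ_μ (comp A K x (N•(y − e_μ)) a (inr μ) − comp A K x (N•y) a (inr μ)) = c_H · Σ′_{x₂} Σ_{κ₂} A x x₂ a (inl κ₂) · gaugeWt N y κ₂ x₂`
— the row of `A` paired with the pure-gauge mode of the block `B(y)` (exchange the finite `μ`-sum with the absolutely convergent
`x₂`-sum, split the fibre index, apply (hH) on field legs and (hM♯) on multiplier legs). -/
theorem row_comp_ward {A K : MKer (d + 1) (Fib d)} {CA δA : ℝ} (hA : Decays A CA δA) (hδA : 0 < δA) {CK : ℝ}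
    (hKb : ∀ x z a b, |K x z a b| ≤ CK) (cH : ℝ)
    (hH : ∀ (y : Site (d + 1)) (κ : Fin (d + 1)) (u : Site (d + 1)),
      ∑ μ, (colH K N μ (y - unitVec μ) κ u - colH K N μ y κ u) = cH * gaugeWt N y κ u)
    (hMf : ∀ (y x₂ : Site (d + 1)) (ρ : Fin (d + 1)),
      ∑ μ, (K x₂ ((N : ℤ) • (y - unitVec μ)) (Sum.inr ρ) (Sum.inr μ) - K x₂ ((N : ℤ) • y) (Sum.inr ρ) (Sum.inr μ)) = 0)
    (x : Site (d + 1)) (a : Fib d) (y : Site (d + 1)) :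
    ∑ μ, (comp A K x ((N : ℤ) • (y - unitVec μ)) a (Sum.inr μ) - comp A K x ((N : ℤ) • y) a (Sum.inr μ)) =
      cH * ∑' x₂, ∑ κ₂, A x x₂ a (Sum.inl κ₂) * gaugeWt N y κ₂ x₂ := by
  have hCA : 0 ≤ CA := hA.nonneg a
  have hs : ∀ (z : Site (d + 1)) (b : Fib d), Summable fun x₂ => ∑ f₂, A x x₂ a f₂ * K x₂ z f₂ b := fun z b => by
    refine summable_sum fun f₂ _ => Summable.of_norm_bounded (((summable_exp_shift hδA x).mul_left CA).mul_right CK) (fun x₂ => ?_)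
    rw [Real.norm_eq_abs, abs_mul]
    exact mul_le_mul (hA x x₂ a f₂) (hKb x₂ z f₂ b) (abs_nonneg _) (mul_nonneg hCA (Real.exp_pos _).le)
  have hs' : ∀ μ : Fin (d + 1), Summable fun x₂ => ∑ f₂, A x x₂ a f₂ *
      (K x₂ ((N : ℤ) • (y - unitVec μ)) f₂ (Sum.inr μ) - K x₂ ((N : ℤ) • y) f₂ (Sum.inr μ)) := fun μ =>
    ((hs ((N : ℤ) • (y - unitVec μ)) (Sum.inr μ)).sub (hs ((N : ℤ) • y) (Sum.inr μ))).congr fun x₂ => by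
      rw [← Finset.sum_sub_distrib]
      exact Finset.sum_congr rfl fun f₂ _ => by ring
  have e1 : ∀ μ : Fin (d + 1), comp A K x ((N : ℤ) • (y - unitVec μ)) a (Sum.inr μ) - comp A K x ((N : ℤ) • y) a (Sum.inr μ) =
      ∑' x₂, ∑ f₂, A x x₂ a f₂ * (K x₂ ((N : ℤ) • (y - unitVec μ)) f₂ (Sum.inr μ) - K x₂ ((N : ℤ) • y) f₂ (Sum.inr μ)) := by
    intro μ
    show (∑' x₂, ∑ f₂, A x x₂ a f₂ * K x₂ ((N : ℤ) • (y - unitVec μ)) f₂ (Sum.inr μ)) -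
        (∑' x₂, ∑ f₂, A x x₂ a f₂ * K x₂ ((N : ℤ) • y) f₂ (Sum.inr μ)) = _
    rw [← (hs ((N : ℤ) • (y - unitVec μ)) (Sum.inr μ)).tsum_sub (hs ((N : ℤ) • y) (Sum.inr μ))]
    refine tsum_congr fun x₂ => ?_
    rw [← Finset.sum_sub_distrib]
    exact Finset.sum_congr rfl fun f₂ _ => by ring
  simp only [e1]
  rw [← Summable.tsum_finsetSum (fun μ _ => hs' μ), ← tsum_mul_left]
  refine tsum_congr fun x₂ => ?_
  rw [Finset.sum_comm]
  simp only [← Finset.mul_sum]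
  rw [Fintype.sum_sum_type]
  have eH : ∀ κ₂ : Fin (d + 1),
      ∑ μ, (K x₂ ((N : ℤ) • (y - unitVec μ)) (Sum.inl κ₂) (Sum.inr μ) - K x₂ ((N : ℤ) • y) (Sum.inl κ₂) (Sum.inr μ)) =
        cH * gaugeWt N y κ₂ x₂ := fun κ₂ => hH y κ₂ x₂
  simp only [eH, hMf y x₂, mul_zero, Finset.sum_const_zero, add_zero]
  rw [Finset.mul_sum]
  exact Finset.sum_congr rfl fun κ₂ _ => by ring

/-- [folklore] **(hM♯) FROM PACKEDNESS**: the source-slot multiplier-column Ward law of `K` on the coarse lattice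
(`KernelWardMColumn.colM_…_ward`) together with the vanishing of the multiplier rows of `K` off the coarse lattice give the full row law at
every fine row index. -/
theorem rowM_ward_of_packed [NeZero N] {K : MKer (d + 1) (Fib d)}
    (hMw : ∀ (y : Site (d + 1)) (ρ : Fin (d + 1)) (w : Site (d + 1)), ∑ μ, (colM K N μ (y - unitVec μ) ρ w - colM K N μ y ρ w) = 0)
    (hoff : ∀ (x : Site (d + 1)), Torus.proj N x ≠ 0 → ∀ (z : Site (d + 1)) (ρ μ : Fin (d + 1)), K x z (Sum.inr ρ) (Sum.inr μ) = 0)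
    (y x₂ : Site (d + 1)) (ρ : Fin (d + 1)) :
    ∑ μ, (K x₂ ((N : ℤ) • (y - unitVec μ)) (Sum.inr ρ) (Sum.inr μ) - K x₂ ((N : ℤ) • y) (Sum.inr ρ) (Sum.inr μ)) = 0 := by
  by_cases hx : Torus.proj N x₂ = 0
  · rw [eq_zsmul_quo_of_proj hx]
    exact hMw y ρ _
  · simp only [hoff x₂ hx, sub_zero, Finset.sum_const_zero]

end Row

/-! ## §3 The differentiated propagator is a right sandwich -/

/-- [folklore] `K2OfK` is the right sandwich of `−(K ∘ dM K N S M ν y′)` with `K` (`SecondOrderResponse.K2OfK`, `comp_neg_left`). -/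
theorem K2OfK_eq_comp_neg {N : ℕ} (K : MKer (d + 1) (Fib d)) (S M : Fin (d + 1) → Site (d + 1) → MKer (d + 1) (Fib d))
    (ν : Fin (d + 1)) (y' : Site (d + 1)) : K2OfK K N S M ν y' = comp (-(comp K (dM K N S M ν y'))) K := by
  rw [comp_neg_left]
  rfl

section Vertex

variable {N : ℕ} [NeZero N]

/-! ## §4 The unfolded first-order vertex over a right sandwich -/

/-- [folklore] **THE UNFOLDED VERTEX OVER A RIGHT SANDWICH READS THE GAUGE MODE**: for `A`, `K` decaying (common rate), (hH)+(hM♯) for `K`, a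
localised field table `S` and a bounded multiplier table `M`,
`divV (dM (comp A K) N S M) y = c_H • (Σ_κ wsum (u ↦ Σ′_{x₂} Σ_{κ₂} A u x₂ (inl κ) (inl κ₂)·ĝ_y(κ₂, x₂)) (S κ)
  + Σ_ρ cwsum N (w ↦ Σ′_{x₂} Σ_{κ₂} A (N•w) x₂ (inr ρ) (inl κ₂)·ĝ_y(κ₂, x₂)) (M ρ))`
(`dM = vertexOfK + vertexOfM`, block bookkeeping of both halves, then §2 inside the weights). -/
theorem divV_dM_comp {A K : MKer (d + 1) (Fib d)} {CA CK δ : ℝ} (hA : Decays A CA δ) (hK : Decays K CK δ) (hδ : 0 < δ) (cH : ℝ)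
    (hH : ∀ (y : Site (d + 1)) (κ : Fin (d + 1)) (u : Site (d + 1)),
      ∑ μ, (colH K N μ (y - unitVec μ) κ u - colH K N μ y κ u) = cH * gaugeWt N y κ u)
    (hMf : ∀ (y x₂ : Site (d + 1)) (ρ : Fin (d + 1)),
      ∑ μ, (K x₂ ((N : ℤ) • (y - unitVec μ)) (Sum.inr ρ) (Sum.inr μ) - K x₂ ((N : ℤ) • y) (Sum.inr ρ) (Sum.inr μ)) = 0)
    {S : Fin (d + 1) → Site (d + 1) → MKer (d + 1) (Fib d)} {Cs δs : ℝ} (hS : LocStencil S Cs δs) (hδs : 0 < δs)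
    {M : Fin (d + 1) → Site (d + 1) → MKer (d + 1) (Fib d)} {B : ℝ} (hM : ∀ ρ w x z a b, |M ρ w x z a b| ≤ B) (y : Site (d + 1)) :
    divV (dM (comp A K) N S M) y =
      cH • (∑ κ, wsum (fun u => ∑' x₂, ∑ κ₂, A u x₂ (Sum.inl κ) (Sum.inl κ₂) * gaugeWt N y κ₂ x₂) (S κ)
        + ∑ ρ, cwsum N (fun w => ∑' x₂, ∑ κ₂, A ((N : ℤ) • w) x₂ (Sum.inr ρ) (Sum.inl κ₂) * gaugeWt N y κ₂ x₂) (M ρ)) := by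
  have hAKd := decays_comp hA hK (half_pos hδ).le (half_lt_self hδ)
  have hAK : ∃ δ' C' : ℝ, 0 < δ' ∧ 0 ≤ C' ∧ Decays (comp A K) C' δ' := ⟨δ / 2, _, half_pos hδ, hAKd.nonneg (Sum.inr 0), hAKd⟩
  have hKb : ∀ x z a b, |K x z a b| ≤ CK := bdd_of_decays hK hδ.le
  rw [show dM (comp A K) N S M = fun μ y => vertexOfK (comp A K) N S μ y + vertexOfM (comp A K) N M μ y from rfl, divV_add,
    divV_vertexOfK (N := N) hAK hS hδs y, divV_vertexOfM_of_bdd (N := N) hAK hM y]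
  have eH : ∀ (κ : Fin (d + 1)) (u : Site (d + 1)), ∑ μ, (colH (comp A K) N μ (y - unitVec μ) κ u - colH (comp A K) N μ y κ u) =
      cH * ∑' x₂, ∑ κ₂, A u x₂ (Sum.inl κ) (Sum.inl κ₂) * gaugeWt N y κ₂ x₂ := fun κ u =>
    row_comp_ward hA hδ hKb cH hH hMf u (Sum.inl κ) y
  have eM : ∀ (ρ : Fin (d + 1)) (w : Site (d + 1)), ∑ μ, (colM (comp A K) N μ (y - unitVec μ) ρ w - colM (comp A K) N μ y ρ w) =
      cH * ∑' x₂, ∑ κ₂, A ((N : ℤ) • w) x₂ (Sum.inr ρ) (Sum.inl κ₂) * gaugeWt N y κ₂ x₂ := fun ρ w =>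
    row_comp_ward hA hδ hKb cH hH hMf ((N : ℤ) • w) (Sum.inr ρ) y
  simp only [eH, eM]
  funext x z a b
  simp only [Pi.smul_apply, Pi.add_apply, Finset.sum_apply, smul_eq_mul, OneStepResolventKernel.wsum, cwsum_apply]
  rw [mul_add, Finset.mul_sum, Finset.mul_sum]
  congr 1
  · refine Finset.sum_congr rfl fun κ _ => ?_
    rw [← tsum_mul_left]
    exact tsum_congr fun u => by ring
  · refine Finset.sum_congr rfl fun ρ _ => ?_
    rw [← tsum_mul_left]
    exact tsum_congr fun w => by ring

/-! ## §5 The response piece of the second-order Ward divergence -/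

/-- [folklore] **THE RESPONSE PIECE OF THE SECOND-ORDER WARD DIVERGENCE READS THE PURE-GAUGE MODE.**  For `K` decaying with the column
Ward laws (hH) (contact `c_H`) and (hM♯), a localised field table `S` and a localised multiplier table `M` (common rate `m`), the
`(μ, y)`-divergence of the fourth summand of `W2OfK` is
`divW (fun μ y ν y′ ↦ dM (K2OfK K N S M ν y′) N S M μ y) y ν y′
   = −(c_H • (Σ_κ wsum (u ↦ Σ′_{x₂} Σ_{κ₂} (K ∘ V)(u, inl κ; x₂, inl κ₂)·ĝ_y(κ₂, x₂)) (S κ)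
             + Σ_ρ cwsum N (w ↦ Σ′_{x₂} Σ_{κ₂} (K ∘ V)(N•w, inr ρ; x₂, inl κ₂)·ĝ_y(κ₂, x₂)) (M ρ)))`, `V := dM K N S M ν y′`:
minus the contact times the unfolded first-order vertex `𝒟_{S,M}` weighted by the fine vector `(K ∘ V) ĝ_y`.  No table law is used. -/
theorem divW_response {K : MKer (d + 1) (Fib d)} {C m : ℝ} (hK : Decays K C m) (hC : 0 ≤ C) (hm : 0 < m)
    {S : Fin (d + 1) → Site (d + 1) → MKer (d + 1) (Fib d)} {Cs : ℝ}
    {M : Fin (d + 1) → Site (d + 1) → MKer (d + 1) (Fib d)} {CM : ℝ} (hS : LocStencil S Cs m) (hM : VertexFamily M N CM m)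
    (cH : ℝ)
    (hH : ∀ (y : Site (d + 1)) (κ : Fin (d + 1)) (u : Site (d + 1)),
      ∑ μ, (colH K N μ (y - unitVec μ) κ u - colH K N μ y κ u) = cH * gaugeWt N y κ u)
    (hMf : ∀ (y x₂ : Site (d + 1)) (ρ : Fin (d + 1)),
      ∑ μ, (K x₂ ((N : ℤ) • (y - unitVec μ)) (Sum.inr ρ) (Sum.inr μ) - K x₂ ((N : ℤ) • y) (Sum.inr ρ) (Sum.inr μ)) = 0)
    (y : Site (d + 1)) (ν : Fin (d + 1)) (y' : Site (d + 1)) :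
    divW (fun μ y ν y' => dM (K2OfK K N S M ν y') N S M μ y) y ν y' =
      -(cH • (∑ κ, wsum (fun u => ∑' x₂, ∑ κ₂,
            comp K (dM K N S M ν y') u x₂ (Sum.inl κ) (Sum.inl κ₂) * gaugeWt N y κ₂ x₂) (S κ)
        + ∑ ρ, cwsum N (fun w => ∑' x₂, ∑ κ₂,
            comp K (dM K N S M ν y') ((N : ℤ) • w) x₂ (Sum.inr ρ) (Sum.inl κ₂) * gaugeWt N y κ₂ x₂) (M ρ))) := by
  have hV := vertexFamily_dM hK hC hS hM hm le_rfl ν y'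
  have hK2 : Decays K C (m / 2) := decays_mono hK hC le_rfl (by linarith)
  have hKV := biLoc_comp_decays hK2 hV (show (0 : ℝ) ≤ m / 4 by positivity) (show m / 4 < m / 2 by linarith)
  have hA : Decays (-(comp K (dM K N S M ν y'))) _ (m / 4) :=
    fun x z a b => decays_of_biLoc (biLoc_neg hKV) (show (0 : ℝ) ≤ m / 4 by positivity) x z a b
  have hK4 : Decays K C (m / 4) := decays_mono hK hC le_rfl (by linarith)
  have hMb : ∀ ρ w x z a b, |M ρ w x z a b| ≤ CM := fun ρ w => bdd_of_biLoc (hM ρ w) hm.le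
  show divV (dM (K2OfK K N S M ν y') N S M) y = _
  rw [K2OfK_eq_comp_neg, divV_dM_comp hA hK4 (by positivity) cH hH hMf hS hm hMb y]
  funext x z a b
  simp only [Pi.smul_apply, Pi.add_apply, Pi.neg_apply, Finset.sum_apply, smul_eq_mul, OneStepResolventKernel.wsum, cwsum_apply,
    neg_mul, Finset.sum_neg_distrib, tsum_neg]
  ring

end Vertex

/-! ## §6 The wall instance: `G_j = coDressKBmAt (toSite r) Lc (KInvStep Lc j)`, every level, every in-block root -/

section Wall

variable {Lc : ℕ} [NeZero Lc]

/-- [folklore] The multiplier rows of the co-dressed step propagator vanish off the coarse lattice (`coDressKBmAt_inr_inr`, `KInvStep_inr_off`). -/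
theorem coDressKBmAt_KInvStep_inr_inr_off (ρ : Site (d + 1)) (j : ℕ) (x : Site (d + 1)) (hx : Torus.proj Lc x ≠ 0) (z : Site (d + 1))
    (ρ' μ : Fin (d + 1)) : coDressKBmAt ρ Lc (KInvStep (d := d) Lc j) x z (Sum.inr ρ') (Sum.inr μ) = 0 := by
  rw [coDressKBmAt_inr_inr]
  exact KInvStep_inr_off j hx ρ' (Sum.inr μ) z

/-- [folklore] **(hM♯) FOR THE WALL PROPAGATOR**, every level, any root: the full homogeneous multiplier-row law of
`coDressKBmAt ρ Lc (KInvStep Lc j)` at every fine row index (`KernelWardMColumn.colM_coDressKBmAt_KInvStep_ward` on the lattice,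
`coDressKBmAt_KInvStep_inr_inr_off` off it). -/
theorem rowM_ward_coDressKBmAt_KInvStep (ρ : Site (d + 1)) (j : ℕ) (y x₂ : Site (d + 1)) (ρ' : Fin (d + 1)) :
    ∑ μ, (coDressKBmAt ρ Lc (KInvStep (d := d) Lc j) x₂ ((Lc : ℤ) • (y - unitVec μ)) (Sum.inr ρ') (Sum.inr μ)
      - coDressKBmAt ρ Lc (KInvStep (d := d) Lc j) x₂ ((Lc : ℤ) • y) (Sum.inr ρ') (Sum.inr μ)) = 0 :=
  rowM_ward_of_packed (colM_coDressKBmAt_KInvStep_ward ρ j) (fun x hx z ρ' μ => coDressKBmAt_KInvStep_inr_inr_off ρ j x hx z ρ' μ) y x₂ ρ'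

/-- [folklore] **THE RESPONSE PIECE OVER THE WALL PROPAGATOR `G_j`**, every level `j`, every in-block root `r`, contact
`c_H = (stepScale d Lc j · Lc^{d+1})⁻¹` ((hH) := `KernelWardHColumnWall.colH_ward_KInvStep_all`, (hM♯) := `rowM_ward_coDressKBmAt_KInvStep`),
for field / multiplier tables localised at a common rate `m`. -/
theorem divW_response_coDressKBmAt_KInvStep {r : Fin (d + 1) → ℕ} (hr : r ∈ box (d + 1) Lc) (j : ℕ)
    {S : Fin (d + 1) → Site (d + 1) → MKer (d + 1) (Fib d)} {Cs : ℝ}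
    {M : Fin (d + 1) → Site (d + 1) → MKer (d + 1) (Fib d)} {CM m : ℝ} (hS : LocStencil S Cs m) (hM : VertexFamily M Lc CM m)
    (hm : 0 < m) (y : Site (d + 1)) (ν : Fin (d + 1)) (y' : Site (d + 1)) :
    divW (fun μ y ν y' => dM (K2OfK (coDressKBmAt (toSite r) Lc (KInvStep (d := d) Lc j)) Lc S M ν y') Lc S M μ y) y ν y' =
      -((stepScale d Lc j * (Lc : ℝ) ^ (d + 1))⁻¹ • (∑ κ, wsum (fun u => ∑' x₂, ∑ κ₂,
            comp (coDressKBmAt (toSite r) Lc (KInvStep (d := d) Lc j))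
              (dM (coDressKBmAt (toSite r) Lc (KInvStep (d := d) Lc j)) Lc S M ν y') u x₂ (Sum.inl κ) (Sum.inl κ₂) *
            gaugeWt Lc y κ₂ x₂) (S κ)
        + ∑ ρ, cwsum Lc (fun w => ∑' x₂, ∑ κ₂,
            comp (coDressKBmAt (toSite r) Lc (KInvStep (d := d) Lc j))
              (dM (coDressKBmAt (toSite r) Lc (KInvStep (d := d) Lc j)) Lc S M ν y') ((Lc : ℤ) • w) x₂ (Sum.inr ρ) (Sum.inl κ₂) *
            gaugeWt Lc y κ₂ x₂) (M ρ))) := by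
  obtain ⟨δ, C, hδ, hC, hG⟩ := decays_coDressKBmAt_KInvStep (d := d) hr j
  have hm₀ : 0 < min m δ := lt_min hm hδ
  have hG' : Decays (coDressKBmAt (toSite r) Lc (KInvStep (d := d) Lc j)) C (min m δ) := decays_mono hG hC le_rfl (min_le_right _ _)
  have hS' : LocStencil S Cs (min m δ) := fun κ u => biLoc_mono (hS κ u) ((hS κ u).nonneg (Sum.inr 0)) (min_le_left _ _)
  have hM' : VertexFamily M Lc CM (min m δ) := fun ρ w => biLoc_mono (hM ρ w) ((hM ρ w).nonneg (Sum.inr 0)) (min_le_left _ _)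
  exact divW_response hG' hC hm₀ hS' hM' _ (colH_ward_KInvStep_all hr j) (rowM_ward_coDressKBmAt_KInvStep (toSite r) j) y ν y'

end Wall

/-! ## §7 The complete first-slot divergence of an2's carrier modulo table laws -/

section Complete

variable {N : ℕ} [NeZero N]

/-- [folklore] **THE COMPLETE `(μ, y)`-DIVERGENCE OF `W2OfK` MODULO TABLE LAWS**: `KernelWardMixedLaw.divW_W2OfK_of_tableLaws` (pieces
P1 = leaf-10's `divW_vertex2OfK_of_tableLaw`, P2 = `divW_mixOfK_of_tableLaw`, P3 = `KernelWardMColumn.divW_mixOfK_swap_eq_zero`) with the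
response piece P4 evaluated by `divW_response`.  Hypotheses: `K` decaying with (hH), the coarse-lattice multiplier-column law (hMw) and
multiplier rows vanishing off the coarse lattice (hoff); tables `S` (localised), `M` (localised, rate `m`), `S₂`, `M₂` (bounded) with the bare
first-slot laws (hS₂), (hM₂) against a spread generator family `X` with bounded remainders `R`, `R^M`.  Conclusion:
`divW (W2OfK K N S M S₂ M₂) y ν y′ = conjV (dM K N S M ν y′) (X y) + dM K N (R y) (R^M y) ν y′ − c_H • 𝒟_{S,M}[(K ∘ dM K N S M ν y′) ĝ_y]`. -/
theorem divW_W2OfK_of_tableLaws_response {K : MKer (d + 1) (Fib d)} {C m : ℝ} (hK : Decays K C m) (hC : 0 ≤ C) (hm : 0 < m)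
    {S : Fin (d + 1) → Site (d + 1) → MKer (d + 1) (Fib d)} {Cs : ℝ} (hS : LocStencil S Cs m)
    {M : Fin (d + 1) → Site (d + 1) → MKer (d + 1) (Fib d)} {CM : ℝ} (hM : VertexFamily M N CM m)
    {S₂ : Fin (d + 1) → Site (d + 1) → Fin (d + 1) → Site (d + 1) → MKer (d + 1) (Fib d)} {B₂ : ℝ}
    (hB₂ : ∀ κ u κ' u' x z a b, |S₂ κ u κ' u' x z a b| ≤ B₂)
    {M₂ : Fin (d + 1) → Site (d + 1) → Fin (d + 1) → Site (d + 1) → MKer (d + 1) (Fib d)} {B₂' : ℝ}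
    (hB₂' : ∀ κ u ρ w x z a b, |M₂ κ u ρ w x z a b| ≤ B₂') (cH : ℝ)
    (hH : ∀ (y : Site (d + 1)) (κ' : Fin (d + 1)) (u : Site (d + 1)),
      ∑ μ, (colH K N μ (y - unitVec μ) κ' u - colH K N μ y κ' u) = cH * gaugeWt N y κ' u)
    (hMw : ∀ (y : Site (d + 1)) (ρ : Fin (d + 1)) (w : Site (d + 1)), ∑ μ, (colM K N μ (y - unitVec μ) ρ w - colM K N μ y ρ w) = 0)
    (hoff : ∀ (x : Site (d + 1)), Torus.proj N x ≠ 0 → ∀ (z : Site (d + 1)) (ρ μ : Fin (d + 1)), K x z (Sum.inr ρ) (Sum.inr μ) = 0)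
    {X : Site (d + 1) → MKer (d + 1) (Fib d)} (hX : ∀ y, Spr (X y))
    {R : Site (d + 1) → Fin (d + 1) → Site (d + 1) → MKer (d + 1) (Fib d)} {BR : ℝ} (hR : ∀ y κ u x z a b, |R y κ u x z a b| ≤ BR)
    {RM : Site (d + 1) → Fin (d + 1) → Site (d + 1) → MKer (d + 1) (Fib d)} {BR' : ℝ} (hRM : ∀ y ρ w x z a b, |RM y ρ w x z a b| ≤ BR')
    (hS₂ : ∀ (y : Site (d + 1)) (κ' : Fin (d + 1)) (u' : Site (d + 1)),
      cH • ∑ v ∈ box (d + 1) N, divV (fun κ u => S₂ κ u κ' u') ((N : ℤ) • y + toSite v) =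
        comp (S κ' u') (X y) - comp (X y) (S κ' u') + R y κ' u')
    (hM₂ : ∀ (y : Site (d + 1)) (ρ : Fin (d + 1)) (w : Site (d + 1)),
      cH • ∑ v ∈ box (d + 1) N, divV (fun κ u => M₂ κ u ρ w) ((N : ℤ) • y + toSite v) =
        comp (M ρ w) (X y) - comp (X y) (M ρ w) + RM y ρ w)
    (y : Site (d + 1)) (ν : Fin (d + 1)) (y' : Site (d + 1)) :
    divW (W2OfK K N S M S₂ M₂) y ν y' =
      conjV (dM K N S M ν y') (X y) + dM K N (R y) (RM y) ν y'
        - cH • (∑ κ, wsum (fun u => ∑' x₂, ∑ κ₂,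
            comp K (dM K N S M ν y') u x₂ (Sum.inl κ) (Sum.inl κ₂) * gaugeWt N y κ₂ x₂) (S κ)
          + ∑ ρ, cwsum N (fun w => ∑' x₂, ∑ κ₂,
            comp K (dM K N S M ν y') ((N : ℤ) • w) x₂ (Sum.inr ρ) (Sum.inl κ₂) * gaugeWt N y κ₂ x₂) (M ρ)) := by
  have hMb : ∀ ρ w x z a b, |M ρ w x z a b| ≤ CM := fun ρ w => bdd_of_biLoc (hM ρ w) hm.le
  rw [divW_W2OfK_of_tableLaws ⟨m, C, hm, hC, hK⟩ hS hm hMb hB₂ hB₂' cH hH hMw hX hR hRM hS₂ hM₂ y ν y',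
    divW_response hK hC hm hS hM cH hH (rowM_ward_of_packed hMw hoff) y ν y', sub_eq_add_neg]

/-- [folklore] **THE COMPLETE `(μ, y)`-DIVERGENCE OF THE CARRIER OVER THE WALL PROPAGATOR `G_j` MODULO TABLE LAWS**, every level `j`,
every in-block root `r`, contact `c_H = (stepScale d Lc j · Lc^{d+1})⁻¹`; (hH), (hMw), (hoff) are THEOREMS for `G_j`
(`KernelWardHColumnWall.colH_ward_KInvStep_all`, `KernelWardMColumn.colM_coDressKBmAt_KInvStep_ward`, `coDressKBmAt_KInvStep_inr_inr_off`). -/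
theorem divW_W2OfK_coDressKBmAt_KInvStep_of_tableLaws_response {Lc : ℕ} [NeZero Lc] {r : Fin (d + 1) → ℕ} (hr : r ∈ box (d + 1) Lc)
    (j : ℕ) {S : Fin (d + 1) → Site (d + 1) → MKer (d + 1) (Fib d)} {Cs : ℝ}
    {M : Fin (d + 1) → Site (d + 1) → MKer (d + 1) (Fib d)} {CM m : ℝ} (hS : LocStencil S Cs m) (hM : VertexFamily M Lc CM m)
    (hm : 0 < m) {S₂ : Fin (d + 1) → Site (d + 1) → Fin (d + 1) → Site (d + 1) → MKer (d + 1) (Fib d)} {B₂ : ℝ}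
    (hB₂ : ∀ κ u κ' u' x z a b, |S₂ κ u κ' u' x z a b| ≤ B₂)
    {M₂ : Fin (d + 1) → Site (d + 1) → Fin (d + 1) → Site (d + 1) → MKer (d + 1) (Fib d)} {B₂' : ℝ}
    (hB₂' : ∀ κ u ρ w x z a b, |M₂ κ u ρ w x z a b| ≤ B₂')
    {X : Site (d + 1) → MKer (d + 1) (Fib d)} (hX : ∀ y, Spr (X y))
    {R : Site (d + 1) → Fin (d + 1) → Site (d + 1) → MKer (d + 1) (Fib d)} {BR : ℝ} (hR : ∀ y κ u x z a b, |R y κ u x z a b| ≤ BR)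
    {RM : Site (d + 1) → Fin (d + 1) → Site (d + 1) → MKer (d + 1) (Fib d)} {BR' : ℝ} (hRM : ∀ y ρ w x z a b, |RM y ρ w x z a b| ≤ BR')
    (hS₂ : ∀ (y : Site (d + 1)) (κ' : Fin (d + 1)) (u' : Site (d + 1)),
      (stepScale d Lc j * (Lc : ℝ) ^ (d + 1))⁻¹ • ∑ v ∈ box (d + 1) Lc, divV (fun κ u => S₂ κ u κ' u') ((Lc : ℤ) • y + toSite v) =
        comp (S κ' u') (X y) - comp (X y) (S κ' u') + R y κ' u')
    (hM₂ : ∀ (y : Site (d + 1)) (ρ : Fin (d + 1)) (w : Site (d + 1)),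
      (stepScale d Lc j * (Lc : ℝ) ^ (d + 1))⁻¹ • ∑ v ∈ box (d + 1) Lc, divV (fun κ u => M₂ κ u ρ w) ((Lc : ℤ) • y + toSite v) =
        comp (M ρ w) (X y) - comp (X y) (M ρ w) + RM y ρ w)
    (y : Site (d + 1)) (ν : Fin (d + 1)) (y' : Site (d + 1)) :
    divW (W2OfK (coDressKBmAt (toSite r) Lc (KInvStep (d := d) Lc j)) Lc S M S₂ M₂) y ν y' =
      conjV (dM (coDressKBmAt (toSite r) Lc (KInvStep (d := d) Lc j)) Lc S M ν y') (X y)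
        + dM (coDressKBmAt (toSite r) Lc (KInvStep (d := d) Lc j)) Lc (R y) (RM y) ν y'
        - (stepScale d Lc j * (Lc : ℝ) ^ (d + 1))⁻¹ • (∑ κ, wsum (fun u => ∑' x₂, ∑ κ₂,
            comp (coDressKBmAt (toSite r) Lc (KInvStep (d := d) Lc j))
              (dM (coDressKBmAt (toSite r) Lc (KInvStep (d := d) Lc j)) Lc S M ν y') u x₂ (Sum.inl κ) (Sum.inl κ₂) *
            gaugeWt Lc y κ₂ x₂) (S κ)
          + ∑ ρ, cwsum Lc (fun w => ∑' x₂, ∑ κ₂,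
            comp (coDressKBmAt (toSite r) Lc (KInvStep (d := d) Lc j))
              (dM (coDressKBmAt (toSite r) Lc (KInvStep (d := d) Lc j)) Lc S M ν y') ((Lc : ℤ) • w) x₂ (Sum.inr ρ) (Sum.inl κ₂) *
            gaugeWt Lc y κ₂ x₂) (M ρ)) := by
  obtain ⟨δ, C, hδ, hC, hG⟩ := decays_coDressKBmAt_KInvStep (d := d) hr j
  have hm₀ : 0 < min m δ := lt_min hm hδ
  have hG' : Decays (coDressKBmAt (toSite r) Lc (KInvStep (d := d) Lc j)) C (min m δ) := decays_mono hG hC le_rfl (min_le_right _ _)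
  have hS' : LocStencil S Cs (min m δ) := fun κ u => biLoc_mono (hS κ u) ((hS κ u).nonneg (Sum.inr 0)) (min_le_left _ _)
  have hM' : VertexFamily M Lc CM (min m δ) := fun ρ w => biLoc_mono (hM ρ w) ((hM ρ w).nonneg (Sum.inr 0)) (min_le_left _ _)
  exact divW_W2OfK_of_tableLaws_response hG' hC hm₀ hS' hM' hB₂ hB₂' _ (colH_ward_KInvStep_all hr j)
    (colM_coDressKBmAt_KInvStep_ward (toSite r) j) (fun x hx z ρ' μ => coDressKBmAt_KInvStep_inr_inr_off (toSite r) j x hx z ρ' μ)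
    hX hR hRM hS₂ hM₂ y ν y'

end Complete

end Summit.QuantumFields.BalabanUV.Beta.KernelWardResponse

end
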